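import Mathlib
import Summits.RiemannHypothesis.RiemannHypothesis.Theses.SpectralTrace
import Literature.NumberTheory.LFunctions.WeilMellinBounds
import Literature.NumberTheory.LFunctions.WeilExplicitProofs
import Literature.NumberTheory.LFunctions.WeilZeroSum

/-!
# Crux `SpectralIsHpSpectrum` (stmt-RiemannHypothesis-0195) — ideator 3, round 1: first lemmas

Signatures only (all `Prop`-valued defs, no proofs, no `sorry`): the first checkable statements of the
two lines filed as crux ideas `pd-twist-levy-uniqueness` and `laplace-probe-log-derivative`, plus the
shared twist lemma. Everything is stated over existing declarations of the tree / Mathlib.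
-/

noncomputable section

open Complex Filter MeasureTheory Set
open scoped Topology ENNReal

namespace Summit.RiemannHypothesis.RiemannHypothesis.Cruxes.SpectralIsHpSpectrum.SketchIdeator3

open Literature.NumberTheory.LFunctions

/-- The hypothesis of the crux: the real family `γ` reproduces the Weil functional on every test. -/
def ReproducesWeil {ι : Type} (γ : ι → ℝ) : Prop :=
  ∀ g : ℝ → ℂ, IsWeilTest g →
    HasSum (fun i => weilMellin g (1 / 2 + (γ i : ℂ) * I)) (weilFunctional g)

/-- Sanity: the crux is literally `∀ ι γ, ReproducesWeil γ → (fibre counts = multiplicities)`. -/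
example :
    Summit.RiemannHypothesis.RiemannHypothesis.Theses.SpectralTrace.SpectralIsHpSpectrum ↔
      ∀ (ι : Type) (γ : ι → ℝ), ReproducesWeil γ → ∀ z : ℂ,
        {i : ι | (1 / 2 : ℂ) + (γ i : ℂ) * Complex.I = z}.encard =
          ZetaZeros.riemannZetaNontrivialZeros.indicator
            (fun w => (analyticOrderNatAt riemannZeta w : ℕ∞)) z :=
  Iff.rfl

/-! ## Shared twist lemma (both cards): a positive-definite test turns the family into a FINITE measure -/

/-- T1. For `k = φ ⋆ φ̃` and a REAL ordinate `t`, `k̂(1/2+it) = ‖φ̂(1/2+it)‖²`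
(`weilMellin_weilConv_holds`, `weilMellin_weilReflect_holds` at `s = 1/2 + it`, where `1 - conj s = s`). -/
def TwistWeightEq : Prop :=
  ∀ (φ : ℝ → ℂ), IsWeilTest φ → ∀ t : ℝ,
    weilMellin (weilConv φ (weilReflect φ)) (1 / 2 + (t : ℂ) * I)
      = (((‖weilMellin φ (1 / 2 + (t : ℂ) * I)‖ ^ 2 : ℝ)) : ℂ)

/-- T2. Total mass: the twisted weights are summable with sum `W(φ ⋆ φ̃)` (hypothesis at `g = φ ⋆ φ̃`). -/
def TwistMass : Prop :=
  ∀ (ι : Type) (γ : ι → ℝ), ReproducesWeil γ → ∀ (φ : ℝ → ℂ), IsWeilTest φ →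
    HasSum (fun i => ‖weilMellin φ (1 / 2 + (γ i : ℂ) * I)‖ ^ 2)
      (weilFunctional (weilConv φ (weilReflect φ))).re

/-- T3. Twisted characteristic-function identity: the hypothesis at the translate `(φ ⋆ φ̃)(· - x)`
(`IsWeilTest.weilTranslate`, `weilMellin_weilTranslate`: `(k_x)^(1/2+iγ) = e^{iγx} k̂(1/2+iγ)`). -/
def TwistedCharFun : Prop :=
  ∀ (ι : Type) (γ : ι → ℝ), ReproducesWeil γ → ∀ (φ : ℝ → ℂ), IsWeilTest φ → ∀ x : ℝ,
    HasSum
      (fun i => (((‖weilMellin φ (1 / 2 + (γ i : ℂ) * I)‖ ^ 2 : ℝ)) : ℂ) * cexp ((γ i : ℂ) * x * I))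
      (weilFunctional (weilTranslate (weilConv φ (weilReflect φ)) x))

/-! ## Card `pd-twist-levy-uniqueness` -/

/-- The twisted spectral measure `Σ_i W(γ_i) δ_{γ_i}` of a real family with weight profile `W ≥ 0`. -/
def twistMeasure {ι : Type} (γ : ι → ℝ) (W : ℝ → ℝ) : Measure ℝ :=
  Measure.sum fun i => ENNReal.ofReal (W (γ i)) • Measure.dirac (γ i)

/-- L1. Atoms of the twisted measure = weight × fibre count (`Measure.sum_apply`, `dirac`,
`ENNReal.tsum_set_const`). This is where `Set.encard` of the crux appears. -/
def TwistMeasureAtom : Prop :=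
  ∀ (ι : Type) (γ : ι → ℝ) (W : ℝ → ℝ) (t : ℝ),
    twistMeasure γ W {t} = {i : ι | γ i = t}.encard * ENNReal.ofReal (W t)

/-- L2. It is a finite measure when the weights are summable (T2), with characteristic function the
twisted trace (T3): `charFun μ x = Σ_i W(γ_i) e^{ixγ_i}` (`charFun_apply_real`, `integral_sum_measure`). -/
def TwistMeasureCharFun : Prop :=
  ∀ (ι : Type) (γ : ι → ℝ) (W : ℝ → ℝ), (∀ t, 0 ≤ W t) → Summable (fun i => W (γ i)) →
    IsFiniteMeasure (twistMeasure γ W) ∧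
      ∀ x : ℝ, charFun (twistMeasure γ W) x = ∑' i, (W (γ i) : ℂ) * cexp ((x : ℂ) * (γ i : ℂ) * I)

/-- L3. Lévy step (Mathlib `MeasureTheory.Measure.ext_of_charFun` on `ℝ`): equal characteristic
functions ⇒ equal atoms. -/
def LevyAtoms : Prop :=
  ∀ (μ ν : Measure ℝ) [IsFiniteMeasure μ] [IsFiniteMeasure ν], charFun μ = charFun ν →
    ∀ t : ℝ, μ {t} = ν {t}

/-- L4. The comparison family under RH: the zeros' twisted measure has the SAME characteristic
function (explicit formula as an absolutely convergent `tsum`, `explicit_formula_holds` +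
`summable_norm_zeroSide` + `hasWeilZeroSide_tsum`; under RH `ρ = 1/2 + i Im ρ`). -/
def ZeroTwistedCharFun : Prop :=
  RiemannHypothesis → ∀ (φ : ℝ → ℂ), IsWeilTest φ → ∀ x : ℝ,
    HasSum
      (fun ρ : ZetaZeros.riemannZetaNontrivialZeros =>
        (riemannZetaZeroOrder (ρ : ℂ) : ℂ) *
          ((((‖weilMellin φ (1 / 2 + ((ρ : ℂ).im : ℂ) * I)‖ ^ 2 : ℝ)) : ℂ) *
            cexp (((ρ : ℂ).im : ℂ) * x * I)))
      (weilFunctional (weilTranslate (weilConv φ (weilReflect φ)) x))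

/-! ## Card `laplace-probe-log-derivative` -/

/-- P1. Residue of the logarithmic derivative at a point of finite order is the order
(`AnalyticAt`, `analyticOrderNatAt`; the RHS of the crux is literally this number for `riemannZeta`). -/
def LogDerivResidue : Prop :=
  ∀ (f : ℂ → ℂ) (z : ℂ), AnalyticAt ℂ f z → analyticOrderAt f z ≠ ⊤ →
    Tendsto (fun s => (s - z) * logDeriv f s) (𝓝[≠] z)
      (𝓝 ((analyticOrderNatAt f z : ℕ) : ℂ))

/-- P1'. Its instance for `ζ` at a point of the critical line (`ζ` analytic at `1/2 + it ≠ 1`,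
finite order by the identity principle as in `analyticOrderNatAt_riemannZeta_ne_zero`); Mathlib has
the simple-zero case `AnalyticAt.tendsto_mul_logDeriv_simple_zero`. -/
def ZetaLogDerivResidue : Prop :=
  ∀ t : ℝ,
    Tendsto (fun σ : ℝ => (σ : ℂ) * logDeriv riemannZeta (1 / 2 + σ + (t : ℂ) * I)) (𝓝[>] 0)
      (𝓝 ((analyticOrderNatAt riemannZeta (1 / 2 + (t : ℂ) * I) : ℕ) : ℂ))

/-- P2. Boundary atom extraction (Abelian limit of the Cauchy–Stieltjes transform of summable
non-negative weights; dominated convergence `tendsto_tsum_of_dominated_convergence`, majorant `w`). -/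
def BoundaryAtom : Prop :=
  ∀ (ι : Type) (γ : ι → ℝ) (w : ι → ℝ), (∀ i, 0 ≤ w i) → Summable w → ∀ (A t₀ : ℝ),
    Tendsto
      (fun σ : ℝ => ∑' i, (w i : ℂ) * cexp (-((σ : ℂ) + ((t₀ - γ i : ℝ) : ℂ) * I) * A) *
        ((σ : ℂ) / ((σ : ℂ) + ((t₀ - γ i : ℝ) : ℂ) * I)))
      (𝓝[>] 0) (𝓝 (∑' i : {i : ι | γ i = t₀}, (w i : ℂ)))

/-- P3. Spectral Laplace transform (Fubini for a summable family of bounded exponentials): for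
`Re s > 1/2`, `∫_A^∞ (Σ_i w_i e^{iγ_i x}) e^{-(s-1/2)x} dx = Σ_i w_i e^{-(s-1/2-iγ_i)A}/(s-1/2-iγ_i)`;
the right side is holomorphic on `Re s > 1/2`. -/
def SpectralLaplace : Prop :=
  ∀ (ι : Type) (γ : ι → ℝ) (w : ι → ℝ), (∀ i, 0 ≤ w i) → Summable w → ∀ (A : ℝ) (s : ℂ),
    1 / 2 < s.re →
      HasSum
        (fun i => (w i : ℂ) * cexp (-(s - 1 / 2 - (γ i : ℂ) * I) * A) / (s - 1 / 2 - (γ i : ℂ) * I))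
        (∫ x in Ioi A, (∑' i, (w i : ℂ) * cexp ((γ i : ℂ) * x * I)) * cexp (-(s - 1 / 2) * x))

/-- P4. Arithmetic Laplace transform of the translated trace (the one place where infinitely many
primes enter): for a test `k` supported in `[-A, A]` and `Re s > 1`,
`∫_A^∞ W(k_x) e^{-(s-1/2)x} dx = -k̂(s)·L(Λ, s) + k̂(1) e^{-(s-1)A}/(s-1) + H(s)` with `H` holomorphic on
`Re s > 0` (prime term: Tonelli + `weilMellin_weilTranslate`; archimedean term in Bombieri's form
`weilArchTermBombieri_eq_weilArchTerm_holds` decays like `e^{-x/2}`; Mathlib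
`LSeries_vonMangoldt_eq_deriv_riemannZeta_div` then rewrites `-L(Λ,s) = ζ'/ζ`). -/
def ArithmeticLaplace : Prop :=
  ∀ (k : ℝ → ℂ), IsWeilTest k → ∀ (A : ℝ), 0 < A → tsupport k ⊆ Icc (-A) A →
    ∃ H : ℂ → ℂ, DifferentiableOn ℂ H {s : ℂ | 0 < s.re} ∧
      ∀ s : ℂ, 1 < s.re →
        ∫ x in Ioi A, weilFunctional (weilTranslate k x) * cexp (-(s - 1 / 2) * x)
          = -(weilMellin k s * LSeries (fun n => ((ArithmeticFunction.vonMangoldt n : ℝ) : ℂ)) s)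
            + weilMellin k 1 * cexp (-(s - 1) * A) / (s - 1) + H s

/-- P5 = the TRANSFER `C⁺` of the card (half-plane identity ⇒ RH, Weil-criterion-free): a reproducing
real family leaves `ζ` no zero off the line (right half by analytic continuation of P3 = P4, left half by
`ZetaZeros.riemannZetaNontrivialZeros.one_sub_conj_mem`). -/
def NoOffLineZero : Prop :=
  ∀ (ι : Type) (γ : ι → ℝ), ReproducesWeil γ →
    ∀ ρ ∈ ZetaZeros.riemannZetaNontrivialZeros, (ρ : ℂ).re = 1 / 2

/-- P6. On-line multiplicities by boundary residues: combining P1–P4 at `s = 1/2 + σ + it₀`, `σ ↓ 0`,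
`k̂(1/2+it₀) · #{i | γ_i = t₀} = k̂(1/2+it₀) · ord_{1/2+it₀} ζ`, and `k̂(1/2+it₀) ≠ 0` for a suitable
`φ` (`exists_isWeilTest_re_weilMellin_pos t₀`). -/
def OnLineMultiplicity : Prop :=
  ∀ (ι : Type) (γ : ι → ℝ), ReproducesWeil γ → ∀ t₀ : ℝ,
    {i : ι | γ i = t₀}.encard = (analyticOrderNatAt riemannZeta (1 / 2 + (t₀ : ℂ) * I) : ℕ∞)

end Summit.RiemannHypothesis.RiemannHypothesis.Cruxes.SpectralIsHpSpectrum.SketchIdeator3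

end
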